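import Mathlib
import Literature.Combinatorics.Additive.TripleProductProperty
import Literature.Computability.AlgebraicComplexity.GroupTheoreticMatMulThmBProofs
import Literature.Computability.AlgebraicComplexity.PrattTrapezoidVal
import Summits.MatrixMultiplication.MatrixMultiplication.Theorems.AutomaticSTPPDesignsAutomaticDesignBelowFourFifthsPacking

/-!
# The mass of an abelian STPP family is at most `|H|^{4/3}`

Support file for route `MatrixMultiplication/AutomaticSTPPDesigns`, crux `stmt-MatrixMultiplication-7356`
(`AutomaticPackingThesis`): the quantity that Pratt's Prop. 3.3 feeds into `Val` — the *mass*
`∑ᵢ |Aᵢ||Bᵢ||Cᵢ|` of an STPP family — can never exceed `|H|^{4/3}` in a finite abelian group `H`.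
Consequently every lower bound for the growth exponent of `Val(ℤ/nℤ)` obtained from ONE cyclic STPP
design through lossless digit-box powers (`AutomaticPackingThesis.addSimultaneousTPP_digitBox`: mass
`m` at modulus `N` gives exponent `log m / log N`) is at most `4/3`, the threshold of Pratt's Thm. 4.7;
and `4/3` itself would require equality below, i.e. `|H|^{1/3}` disjoint TPP triples of volume exactly
`|H|`, a configuration which by CKSU 2005 Thm. 5.5 (`∑ (|A||B||C|)^{ω/3} ≤ |H|`) certifies `ω = 2`
from a single finite group.

Proof (elementary): the three packing bounds `∑|A||B|, ∑|B||C|, ∑|C||A| ≤ |H|`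
(`AddSimultaneousTPP.sum_card_mul_card_le`, BCCGNSU 2017 §2 / Pratt Prop. 2.3, after rotating the
family with the tree's `AutomaticDesignBelowFourFifths.rotate`) and the single-triple bound `|Aᵢ||Bᵢ||Cᵢ| ≤ |H|` (`AddSimultaneousTPP.card_mul_card_mul_card_le`,
TPP injectivity) give, with `xᵢ = |Aᵢ||Bᵢ||Cᵢ|`,
`xᵢ = xᵢ^{1/3} xᵢ^{2/3} ≤ |H|^{1/3} (|Aᵢ||Bᵢ| · |Bᵢ||Cᵢ| · |Cᵢ||Aᵢ|)^{1/3} ≤ |H|^{1/3} (|Aᵢ||Bᵢ| + |Bᵢ||Cᵢ| + |Cᵢ||Aᵢ|)/3`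
(AM–GM), and summing, `∑ xᵢ ≤ |H|^{1/3} · |H|`.

## References

* H. Cohn, R. Kleinberg, B. Szegedy, C. Umans, FOCS 2005, arXiv:math/0511460, Def. 5.1, Thm. 5.5.
* J. Blasiak, T. Church, H. Cohn, J. Grochow, E. Naslund, W. Sawin, C. Umans, Discrete Analysis
  2017:3, §2 (packing bounds).
* K. Pratt, ITCS 2024, arXiv:2309.03878, Prop. 2.3, Prop. 3.3, Thm. 4.7.
-/

-- single-conjunct summit: the mandated namespace repeats `MatrixMultiplication`.
set_option linter.dupNamespace false

noncomputable section

namespace Summit.MatrixMultiplication.MatrixMultiplication.Theorems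

namespace STPPMassCap

open Finset Literature.Combinatorics.Additive AutomaticDesignBelowFourFifths

variable {H : Type*} [AddCommGroup H] [Fintype H] [DecidableEq H]
variable {ι : Type*} [Fintype ι] {A B C : ι → Finset H}

/-- **AM–GM step**: for reals `a, b, c ≥ 0` with `abc ≤ N`,
`abc ≤ N^{1/3} · (ab + bc + ca)/3`. [folklore] -/
theorem mul_three_le_rpow_third_mul {a b c N : ℝ} (ha : 0 ≤ a) (hb : 0 ≤ b) (hc : 0 ≤ c)
    (hN : a * b * c ≤ N) :
    a * b * c ≤ N ^ ((1 : ℝ) / 3) * ((a * b + b * c + c * a) / 3) := by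
  set x : ℝ := a * b * c with hx
  have hx0 : 0 ≤ x := by positivity
  have hN0 : 0 ≤ N := hx0.trans hN
  -- `x = x^{1/3} · x^{2/3}` and `x^{2/3} = ((ab)(bc)(ca))^{1/3}`
  have hsplit : x = x ^ ((1 : ℝ) / 3) * x ^ ((2 : ℝ) / 3) := by
    rw [← Real.rpow_add' hx0 (by norm_num : (1 : ℝ) / 3 + 2 / 3 ≠ 0)]
    norm_num
  have hsq : x ^ ((2 : ℝ) / 3) = ((a * b) * (b * c) * (c * a)) ^ ((1 : ℝ) / 3) := by
    have : (a * b) * (b * c) * (c * a) = x ^ (2 : ℕ) := by rw [hx]; ring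
    rw [this, ← Real.rpow_natCast, ← Real.rpow_mul hx0]
    norm_num
  -- AM–GM for three terms with equal weights
  have hamgm : ((a * b) * (b * c) * (c * a)) ^ ((1 : ℝ) / 3) ≤ (a * b + b * c + c * a) / 3 := by
    have hab : 0 ≤ a * b := by positivity
    have hbc : 0 ≤ b * c := by positivity
    have hca : 0 ≤ c * a := by positivity
    have key := Real.geom_mean_le_arith_mean3_weighted (by norm_num : (0 : ℝ) ≤ 1 / 3)
      (by norm_num : (0 : ℝ) ≤ 1 / 3) (by norm_num : (0 : ℝ) ≤ 1 / 3) hab hbc hca (by norm_num)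
    rw [Real.mul_rpow (by positivity) hca, Real.mul_rpow hab hbc]
    linarith
  have h13 : x ^ ((1 : ℝ) / 3) ≤ N ^ ((1 : ℝ) / 3) :=
    Real.rpow_le_rpow hx0 hN (by norm_num)
  calc x = x ^ ((1 : ℝ) / 3) * x ^ ((2 : ℝ) / 3) := hsplit
    _ ≤ N ^ ((1 : ℝ) / 3) * x ^ ((2 : ℝ) / 3) :=
        mul_le_mul_of_nonneg_right h13 (Real.rpow_nonneg hx0 _)
    _ ≤ N ^ ((1 : ℝ) / 3) * ((a * b + b * c + c * a) / 3) := by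
        rw [hsq]
        exact mul_le_mul_of_nonneg_left hamgm (Real.rpow_nonneg hN0 _)

/-- **Mass cap for abelian STPP families.** If `(Aᵢ, Bᵢ, Cᵢ)_{i ∈ ι}` is an STPP family of nonempty
sets in a finite abelian group `H`, then `∑ᵢ |Aᵢ||Bᵢ||Cᵢ| ≤ |H|^{4/3}`.
[cite: BlasiakChurchCohnGrochowNaslundSawinUmans2017, §2 (packing bounds)] -/
theorem sum_card_mul_le_rpow (h : AddSimultaneousTPP A B C) (hA : ∀ i, (A i).Nonempty)
    (hB : ∀ i, (B i).Nonempty) (hC : ∀ i, (C i).Nonempty) :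
    ((∑ i, #(A i) * #(B i) * #(C i) : ℕ) : ℝ) ≤ (Fintype.card H : ℝ) ^ ((4 : ℝ) / 3) := by
  have hN0 : 0 ≤ (Fintype.card H : ℝ) := by positivity
  -- the three packing bounds (rotating the family) and the single-triple bound
  have hAB : ((∑ i, #(A i) * #(B i) : ℕ) : ℝ) ≤ (Fintype.card H : ℝ) := by
    exact_mod_cast h.sum_card_mul_card_le hC
  have hBC : ((∑ i, #(B i) * #(C i) : ℕ) : ℝ) ≤ (Fintype.card H : ℝ) := by
    exact_mod_cast (rotate h).sum_card_mul_card_le hA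
  have hCA : ((∑ i, #(C i) * #(A i) : ℕ) : ℝ) ≤ (Fintype.card H : ℝ) := by
    exact_mod_cast (rotate (rotate h)).sum_card_mul_card_le hB
  have hvol : ∀ i, ((#(A i) * #(B i) * #(C i) : ℕ) : ℝ) ≤ (Fintype.card H : ℝ) := fun i => by
    exact_mod_cast h.card_mul_card_mul_card_le i
  -- termwise AM–GM and summation
  have hterm : ∀ i, ((#(A i) * #(B i) * #(C i) : ℕ) : ℝ) ≤
      (Fintype.card H : ℝ) ^ ((1 : ℝ) / 3) *
        (((#(A i) : ℝ) * #(B i) + (#(B i) : ℝ) * #(C i) + (#(C i) : ℝ) * #(A i)) / 3) := by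
    intro i
    have := mul_three_le_rpow_third_mul (N := (Fintype.card H : ℝ)) (Nat.cast_nonneg (#(A i)))
      (Nat.cast_nonneg (#(B i))) (Nat.cast_nonneg (#(C i))) (by exact_mod_cast hvol i)
    exact_mod_cast this
  calc ((∑ i, #(A i) * #(B i) * #(C i) : ℕ) : ℝ)
      = ∑ i, ((#(A i) * #(B i) * #(C i) : ℕ) : ℝ) := by push_cast; rfl
    _ ≤ ∑ i, (Fintype.card H : ℝ) ^ ((1 : ℝ) / 3) *
          (((#(A i) : ℝ) * #(B i) + (#(B i) : ℝ) * #(C i) + (#(C i) : ℝ) * #(A i)) / 3) :=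
        sum_le_sum fun i _ => hterm i
    _ = (Fintype.card H : ℝ) ^ ((1 : ℝ) / 3) * ((((∑ i, #(A i) * #(B i) : ℕ) : ℝ) +
          ((∑ i, #(B i) * #(C i) : ℕ) : ℝ) + ((∑ i, #(C i) * #(A i) : ℕ) : ℝ)) / 3) := by
        rw [← mul_sum, ← sum_div]
        push_cast
        rw [sum_add_distrib, sum_add_distrib]
    _ ≤ (Fintype.card H : ℝ) ^ ((1 : ℝ) / 3) * (Fintype.card H : ℝ) := by
        refine mul_le_mul_of_nonneg_left ?_ (Real.rpow_nonneg hN0 _)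
        linarith
    _ = (Fintype.card H : ℝ) ^ ((4 : ℝ) / 3) := by
        rw [show (4 : ℝ) / 3 = 1 / 3 + 1 by norm_num, Real.rpow_add_one' hN0 (by norm_num)]

/-- **Corollary for `Val` certificates** (the form used with Pratt's Prop. 3.3): an STPP family of
nonempty sets in `ℤ/Nℤ` has mass at most `N^{4/3}`, so the exponent `log(mass)/log N` certified by
digit-box powering of a single design never exceeds `4/3`. [cite: Pratt2024, Prop. 3.3 and Thm. 4.7] -/
theorem sum_card_mul_le_rpow_zmod {N : ℕ} [NeZero N] {ι : Type*} [Fintype ι]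
    {A B C : ι → Finset (ZMod N)} (h : AddSimultaneousTPP A B C) (hA : ∀ i, (A i).Nonempty)
    (hB : ∀ i, (B i).Nonempty) (hC : ∀ i, (C i).Nonempty) :
    ((∑ i, #(A i) * #(B i) * #(C i) : ℕ) : ℝ) ≤ (N : ℝ) ^ ((4 : ℝ) / 3) := by
  have := sum_card_mul_le_rpow h hA hB hC
  rwa [ZMod.card] at this

end STPPMassCap

end Summit.MatrixMultiplication.MatrixMultiplication.Theorems

end
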